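/-
Copyright (c) 2026. All rights reserved.
Released under Apache 2.0 license as described in the file LICENSE.
Authors: abc-iut cell, F lane seat abc-iut-f-073 (gen 6; KEY INST59H2), over abc-iut-L4-t5's statements
(`FrobeniusPictureMLFTelecore.lean`, `FrobeniusPictureMLFCompatibility.lean`, `FrobeniusPictureMLFCompatibilityTransport.lean`)
and abc-iut-w6-d025's model theorems (`FrobeniusPictureMLFLogTeleModel.lean`); everything consumed BY NAME.
-/
import Literature.AnabelianGeometry.AbsoluteAnabelian.AbsTopIII.FrobeniusPictureMLFCompatibilityTransport
import Literature.AnabelianGeometry.AbsoluteAnabelian.AbsTopIII.FrobeniusPictureMLFLogTeleModel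
import HarnessLib

/-!
# FACT-LIST row F-0361 `LogFrobeniusData.TeleLogPinned` ([AbsTopIII] Cor 3.6 (iv)) — the POSITIVE instance forms:
# the `𝔖_log`-pinning predicate HOLDS for every common family of `𝒥_{𝔗_An}` and `𝔖_log`

S. Mochizuki, *Topics in Absolute Anabelian Geometry III*, J. Math. Sci. Univ. Tokyo 22 (2015) [MochizukiAbsTopIII2015]
(kurims manuscript `paper:url-5493eb38cbb7`): Cor. 3.6 (iii) p. 80 («the natural transformations `ι_{log,⋎}`, `ι_×`
belong to a family of homotopies … compatible with the families of homotopies that constitute the core and telecore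
structures of (i), (ii)»), Cor. 3.6 (iv) p. 80 l. 19–21 with proof p. 82 (`𝔗_An`, `ℋ_An`, `𝔖_log` not simultaneously
compatible), Rmk. 3.7.3 (ii) p. 91.

PROOF-ONLY companion (no `def`, nothing restated) of abc-iut-L4-t5's `FrobeniusPictureMLFTelecore.lean`.  The row
F-0361 is the PREDICATE `Δ.TeleLogPinned K` on a family `K` of homotopies on a telecore diagram `𝒟_An` over the
abstract datum `Δ : LogFrobeniusData`: «`K` contains the `𝔖_log` generators — the type-(2) pair `([λ^×], [λ^{×pf}])`
with homotopy `ι_×` and, for every `⋎`, the type-(1) pair `([λ^×]∘[id_⋎]∘[log], [λ^{×pf}]∘[id_{⋎+1}])` with homotopy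
`ι_{log,⋎}`».  Kernel status before this file: ONLY NEGATIVE occurrences — the universal closure refuted
(`not_forall_teleLogPinned`) and named families at which the predicate FAILS (`exists_not_teleLogPinned_model`,
`arch_exists_not_teleLogPinned`: the common family of `ℋ_An ∪ 𝒥`, by Cor. 3.6 (iv)).  This file supplies the
POSITIVE side:

* `teleLogPinned_of_logPinned_compatibleAlong` — **TRANSFER along `𝒟_{≤3} ↪ 𝒟_An`** (every `Δ`, every family of
  telecore edges): if a family `H` on `𝒟_{≤3}` is `𝔖_log`-pinned (`Δ.LogPinned H`, the typed Cor. 3.6 (iii)) and is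
  contained (Def. 3.5 (ii), `CompatibleAlong (embLogTele J)`) in a family `K` on the telecore diagram, then `K` is
  `𝔖_log`-pinned: `Δ.TeleLogPinned K`.  (The path functors along the embedding agree — abc-iut-L4-t5's
  `heq_pathFunctor_embLogTele` — and the homotopies agree heterogeneously, so the pinned components transport.)
* `exists_teleLogPinned_of_logObsCompatTelecoreStmt` — **Cor. 3.6 (iii), second clause, telecore half, READ THROUGH
  F-0361**: wherever `LogObsCompatTelecoreStmt τ` holds (one family on `𝒟_An` containing the telecore family `𝒥` of a
  telecore `𝔗_An` of the printed shape and the `𝔖_log` family), there ARE a telecore `T` of the printed shape and a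
  family `K ⊇ 𝒥_T` on its diagram with `TeleLogPinned K` — `𝔗_An` and `𝔖_log` ARE simultaneously compatible; by the
  typed Cor. 3.6 (iv) (`TelecoreIncompatibleStmt`) it is exactly the contact structure `ℋ_An` that cannot be added
  (compare `exists_not_teleLogPinned_of_telecoreStmt`: same shape of conclusion with `ContactGen ⊆ K` and
  `¬ TeleLogPinned K`).
* `AbsTopIII.TFModel.exists_teleLogPinned_model` — **∃-WITNESS AT THE MLF-GALOIS MODEL** `𝒳 = 𝒞^{MLF-sB}_{TF}` of
  abc-iut-L4-t5 (every prime `p`, type `P`, Cor-1.10 datum `I`, telecore datum `τ`), from abc-iut-w6-d025's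
  unconditional `logObsCompatTelecoreStmt_model`; and the ZERO-BINDER forms
  `exists_teleLogPinned_isAffineModel_two` / `exists_teleLogPinned_isAffineModelAn_two` at the non-vacuous affine
  sub-models `𝒳_{P₀}`, `𝒳_{P₀^an}` over `ℚ̄₂` with the printed telecore datum `⟨φ_An, 𝟙, η_An⟩`.

HONEST FRAMING: refereed pre-IUT material; theorems about OUR typed statements (abstract data, resp. OUR model
carriers), not theorems about IUT in print; nothing here bears on [IUTchIII] Cor. 3.12; no side taken; model-level ≠
node-level; typed ≠ proved.
-/

set_option autoImplicit false

namespace Literature.AnabelianGeometry.AbsoluteAnabelian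

open _root_.CategoryTheory _root_.Quiver

universe u

/-! ### `eqToHom` / `HEq` bookkeeping -/

section Bookkeeping

universe v₁ v₂ u₁ u₂

/-- Components of heterogeneously equal natural transformations between equal functors. [folklore] -/
private theorem app_eq_of_heq₄ {C : Type u₁} [Category.{v₁} C] {C' : Type u₂} [Category.{v₂} C']
    {F G F' G' : C ⥤ C'} (hF : F = F') (hG : G = G') {α : F ⟶ G} {β : F' ⟶ G'} (h : HEq α β)
    (X : C) :
    β.app X = eqToHom (Functor.congr_obj hF X).symm ≫ α.app X ≫ eqToHom (Functor.congr_obj hG X) := by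
  subst hF hG
  simp [eq_of_heq h]

/-- Merging the `eqToHom`s of a singly nested conjugate. [folklore] -/
private theorem eqToHom_sandwich₄ {C : Type u₁} [Category.{v₁} C] {A B₁ B₂ C₁ C₂ E : C} (p : A = B₁)
    (q : B₁ = B₂) (m : B₂ ⟶ C₁) (r : C₁ = C₂) (s : C₂ = E) :
    eqToHom p ≫ (eqToHom q ≫ m ≫ eqToHom r) ≫ eqToHom s =
      eqToHom (p.trans q) ≫ m ≫ eqToHom (r.trans s) := by
  cases p; cases q; cases r; cases s; simp

end Bookkeeping

namespace LogFrobeniusData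

open DiagramOfCategories

variable (Δ : LogFrobeniusData.{u})

/-! ### Transfer of the `𝔖_log`-pinning along `𝒟_{≤3} ↪ 𝒟_An` -/

section Transfer

variable {J : SubVertex {a : LFVertex | a.row ≤ 4} → Type u}
  {telMap : ∀ {a}, J a → (Δ.A ⥤ (Δ.sub 4).obj a)}

/-- **F-0361, TRANSFER (every datum `Δ`, every family of telecore edges)**: a family `K` of homotopies on the
telecore diagram `𝒟_An` which CONTAINS, along `𝒟_{≤3} ↪ 𝒟_An` (Def. 3.5 (ii)), an `𝔖_log`-pinned family `H` on
`𝒟_{≤3}` (`Δ.LogPinned H`: the typed Cor. 3.6 (iii) «`ι_{log,⋎}` (respectively, `ι_×`) determine(s) the homotopies for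
pairs of type (1) (respectively, (2))») is itself `𝔖_log`-pinned in the sense of Cor. 3.6 (iv): `Δ.TeleLogPinned K`.
The two path functors along the embedding agree (`heq_pathFunctor_embLogTele`), the homotopies agree
heterogeneously, hence componentwise through `eqToHom`s. [cite: MochizukiAbsTopIII2015, Corollary 3.6 (iv) p.82] -/
theorem teleLogPinned_of_logPinned_compatibleAlong (H : Δ.sub3.HomotopyFamily) (hH : Δ.LogPinned H)
    (K : (Δ.teleDiagram J telMap).HomotopyFamily) (hK : H.CompatibleAlong (embLogTele J) K) :
    Literature.AnabelianGeometry.AbsoluteAnabelian.LogFrobeniusData.TeleLogPinned Δ K := by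
  obtain ⟨htimes, hlog⟩ := hH
  -- the functor identifications along `embLogTele` for the four kinds of pinned paths
  have hFT : Δ.sub3.pathFunctor ((Path.nil : Path lvNexus.{u} lvNexus).cons eLamTimes) =
      (Δ.teleDiagram J telMap).pathFunctor
        ((embLogTele J).mapPath ((Path.nil : Path lvNexus.{u} lvNexus).cons eLamTimes)) :=
    eq_of_heq (Δ.heq_pathFunctor_embLogTele J telMap _)
  have hFP : Δ.sub3.pathFunctor ((Path.nil : Path lvNexus.{u} lvNexus).cons eLamPf) =
      (Δ.teleDiagram J telMap).pathFunctor
        ((embLogTele J).mapPath ((Path.nil : Path lvNexus.{u} lvNexus).cons eLamPf)) :=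
    eq_of_heq (Δ.heq_pathFunctor_embLogTele J telMap _)
  have hFL : ∀ n : ℤ, Δ.sub3.pathFunctor (logPairLeft.{u} n) =
      (Δ.teleDiagram J telMap).pathFunctor ((embLogTele J).mapPath (logPairLeft.{u} n)) := fun n =>
    eq_of_heq (Δ.heq_pathFunctor_embLogTele J telMap _)
  have hFR : ∀ n : ℤ, Δ.sub3.pathFunctor (logPairRight.{u} n) =
      (Δ.teleDiagram J telMap).pathFunctor ((embLogTele J).mapPath (logPairRight.{u} n)) := fun n =>
    eq_of_heq (Δ.heq_pathFunctor_embLogTele J telMap _)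
  refine ⟨?_, fun n => ?_⟩
  · -- type (2): `([λ^×], [λ^{×pf}])` with `ι_×` (either orientation of `ι_×`)
    revert htimes
    rcases hι : Δ.ιtimes with ι | ι <;> intro htimes <;> obtain ⟨hT, hhT⟩ := htimes
    · obtain ⟨hT', hheq⟩ := hK _ _ hT
      refine ⟨hT', fun x e₁ e₂ => ?_⟩
      refine (app_eq_of_heq₄ hFT hFP hheq x).trans ?_
      rw [hhT x (Δ.timesPair_obj x).1 (Δ.timesPair_obj x).2]
      exact eqToHom_sandwich₄ _ _ _ _ _
    · obtain ⟨hT', hheq⟩ := hK _ _ hT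
      refine ⟨hT', fun x e₁ e₂ => ?_⟩
      refine (app_eq_of_heq₄ hFP hFT hheq x).trans ?_
      rw [hhT x (Δ.timesPair_obj x).2 (Δ.timesPair_obj x).1]
      exact eqToHom_sandwich₄ _ _ _ _ _
  · -- type (1): `([λ^×]∘[id_⋎]∘[log], [λ^{×pf}]∘[id_{⋎+1}])` with `ι_{log,⋎}`
    obtain ⟨hL, hhL⟩ := hlog n
    obtain ⟨hL', hheq⟩ := hK _ _ hL
    refine ⟨hL', fun x e₁ e₂ => ?_⟩
    refine (app_eq_of_heq₄ (hFL n) (hFR n) hheq x).trans ?_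
    rw [hhL x (Δ.logPair_obj n x).1 (Δ.logPair_obj n x).2]
    exact eqToHom_sandwich₄ _ _ _ _ _

end Transfer

/-! ### From the typed Cor. 3.6 (iii), second clause (telecore half) -/

/-- **F-0361 from `LogObsCompatTelecoreStmt`** (every `Δ`, every first-row telecore datum `τ`): if ONE family on a
telecore diagram `𝒟_An` contains the telecore family `𝒥` of a telecore `𝔗_An` of the printed shape and, along
`𝒟_{≤3} ↪ 𝒟_An`, the `𝔖_log` family (the typed second clause of Cor. 3.6 (iii), telecore half), then there ARE such a
telecore `T` and a family `K ⊇ 𝒥_T` on its diagram which is `𝔖_log`-PINNED (`TeleLogPinned K`) — `𝔗_An` and `𝔖_log`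
are simultaneously compatible (cf. Rmk. 3.7.3 (ii)); contrast `exists_not_teleLogPinned_of_telecoreStmt`, where the
family also contains the contact generators `ℋ_An` and then is NOT pinned (Cor. 3.6 (iv)).
[cite: MochizukiAbsTopIII2015, Corollary 3.6 (iii) p.80] -/
theorem exists_teleLogPinned_of_logObsCompatTelecoreStmt (τ : Δ.TelecoreData)
    (h : Δ.LogObsCompatTelecoreStmt τ) :
    ∃ (H₅ : Δ.core5Diagram.HomotopyFamily)
      (hH₅ : ∀ ⦃a b : coreShape5.{u}.Vertex⦄ ⦃p q : Path a b⦄, H₅.E p q → b = coreShape5.{u}.obs)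
      (hc : (Δ.coreObs5 H₅ hH₅).IsCore) (T : (Δ.sub 4).Telecore (Δ.coreObs5 H₅ hH₅) hc)
      (K : (Δ.teleDiagram T.J T.telMap).HomotopyFamily),
      Δ.IsTelecoreAn τ T ∧
      (∀ ⦃a b : (teleShape T.J).Vertex⦄ (p q : Path a b), T.Jfam.E p q → K.E p q) ∧
      Literature.AnabelianGeometry.AbsoluteAnabelian.LogFrobeniusData.TeleLogPinned Δ K := by
  obtain ⟨H₅, hH₅, hc, T, hT, K, hJ, H₃, ⟨-, -, hpin⟩, hc₃⟩ := h
  refine ⟨H₅, hH₅, hc, T, K, hT, fun a b p q hpq => ?_,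
    Δ.teleLogPinned_of_logPinned_compatibleAlong H₃ hpin K hc₃⟩
  obtain ⟨h', -⟩ := hJ p q hpq
  rw [Prefunctor.mapPath_id, Prefunctor.mapPath_id] at h'
  exact h'

end LogFrobeniusData

/-! ### At the MLF-Galois model `𝒳 = 𝒞^{MLF-sB}_{TF}` -/

namespace AbsTopIII

namespace TFModel

variable {p : ℕ} [Fact p.Prime] {P : ObjectProperty (TFModel p)} {D : Type 1} [Category.{1} D]

/-- **F-0361, ∃-WITNESS AT THE MLF-GALOIS MODEL** (every prime `p`, type `P`, Cor-1.10 datum `I`, telecore datum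
`τ`): over the model log-Frobenius data of abc-iut-L4-t5's `FrobeniusPictureMLFModel.lean` there are a telecore
`𝔗_An` of the printed shape and a family `K ⊇ 𝒥` on `𝒟_An` which is `𝔖_log`-PINNED — from abc-iut-w6-d025's
unconditional `logObsCompatTelecoreStmt_model` (F-0360 at the model) through
`exists_teleLogPinned_of_logObsCompatTelecoreStmt`. [cite: MochizukiAbsTopIII2015, Corollary 3.6 (iii) p.80] -/
theorem exists_teleLogPinned_model (I : AnabelianInput p P D)
    (τ : (monoAnabelianData I).toLogFrobeniusData.TelecoreData) :
    ∃ (H₅ : (monoAnabelianData I).toLogFrobeniusData.core5Diagram.HomotopyFamily)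
      (hH₅ : ∀ ⦃a b : LogFrobeniusData.coreShape5.Vertex⦄ ⦃p q : Path a b⦄,
        H₅.E p q → b = LogFrobeniusData.coreShape5.obs)
      (hc : ((monoAnabelianData I).toLogFrobeniusData.coreObs5 H₅ hH₅).IsCore)
      (T : ((monoAnabelianData I).toLogFrobeniusData.sub 4).Telecore
        ((monoAnabelianData I).toLogFrobeniusData.coreObs5 H₅ hH₅) hc)
      (K : ((monoAnabelianData I).toLogFrobeniusData.teleDiagram T.J T.telMap).HomotopyFamily),
      (monoAnabelianData I).toLogFrobeniusData.IsTelecoreAn τ T ∧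
      (∀ ⦃a b : (LogFrobeniusData.teleShape T.J).Vertex⦄ (p q : Path a b), T.Jfam.E p q → K.E p q) ∧
      Literature.AnabelianGeometry.AbsoluteAnabelian.LogFrobeniusData.TeleLogPinned
        (monoAnabelianData I).toLogFrobeniusData K :=
  (monoAnabelianData I).toLogFrobeniusData.exists_teleLogPinned_of_logObsCompatTelecoreStmt τ
    (logObsCompatTelecoreStmt_model I τ)

/-- **F-0361, ZERO-BINDER ∃-WITNESS at the non-vacuous affine sub-model `𝒳_{P₀}` over `ℚ̄₂`** (datum
`AnabelianInput.ofFull 2 IsAffineModel …` of `MLFGaloisModelAffineWitnessFull.lean`) with the PRINTED telecore datum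
`⟨φ_An, 𝟙, η_An⟩`: a telecore of the printed shape and an `𝔖_log`-pinned family `K ⊇ 𝒥` on its diagram exist.
[cite: MochizukiAbsTopIII2015, Corollary 3.6 (iii) p.80] -/
theorem exists_teleLogPinned_isAffineModel_two :
    ∃ (H₅ : (monoAnabelianData (AnabelianInput.ofFull 2 (IsAffineModel (p := 2))
          full_galP_isAffineModel)).toLogFrobeniusData.core5Diagram.HomotopyFamily)
      (hH₅ : ∀ ⦃a b : LogFrobeniusData.coreShape5.Vertex⦄ ⦃p q : Path a b⦄,
        H₅.E p q → b = LogFrobeniusData.coreShape5.obs)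
      (hc : ((monoAnabelianData (AnabelianInput.ofFull 2 (IsAffineModel (p := 2))
          full_galP_isAffineModel)).toLogFrobeniusData.coreObs5 H₅ hH₅).IsCore)
      (T : ((monoAnabelianData (AnabelianInput.ofFull 2 (IsAffineModel (p := 2))
          full_galP_isAffineModel)).toLogFrobeniusData.sub 4).Telecore
        ((monoAnabelianData (AnabelianInput.ofFull 2 (IsAffineModel (p := 2))
          full_galP_isAffineModel)).toLogFrobeniusData.coreObs5 H₅ hH₅) hc)
      (K : ((monoAnabelianData (AnabelianInput.ofFull 2 (IsAffineModel (p := 2))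
          full_galP_isAffineModel)).toLogFrobeniusData.teleDiagram T.J T.telMap).HomotopyFamily),
      (monoAnabelianData (AnabelianInput.ofFull 2 (IsAffineModel (p := 2))
          full_galP_isAffineModel)).toLogFrobeniusData.IsTelecoreAn
        (monoAnabelianData (AnabelianInput.ofFull 2 (IsAffineModel (p := 2))
          full_galP_isAffineModel)).telecoreData T ∧
      (∀ ⦃a b : (LogFrobeniusData.teleShape T.J).Vertex⦄ (p q : Path a b), T.Jfam.E p q → K.E p q) ∧
      Literature.AnabelianGeometry.AbsoluteAnabelian.LogFrobeniusData.TeleLogPinned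
        (monoAnabelianData (AnabelianInput.ofFull 2 (IsAffineModel (p := 2))
          full_galP_isAffineModel)).toLogFrobeniusData K :=
  exists_teleLogPinned_model _ _

/-- **F-0361, ZERO-BINDER ∃-WITNESS at the SLIM sub-model `𝒳_{P₀^an}` over `ℚ̄₂`** (datum `AnabelianInput.ofFull 2
IsAffineModelAn …` of `MLFGaloisModelAffineWitnessSlimProofs.lean`), printed telecore datum.
[cite: MochizukiAbsTopIII2015, Corollary 3.6 (iii) p.80] -/
theorem exists_teleLogPinned_isAffineModelAn_two :
    ∃ (H₅ : (monoAnabelianData (AnabelianInput.ofFull 2 (IsAffineModelAn (p := 2))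
          full_galP_isAffineModelAn)).toLogFrobeniusData.core5Diagram.HomotopyFamily)
      (hH₅ : ∀ ⦃a b : LogFrobeniusData.coreShape5.Vertex⦄ ⦃p q : Path a b⦄,
        H₅.E p q → b = LogFrobeniusData.coreShape5.obs)
      (hc : ((monoAnabelianData (AnabelianInput.ofFull 2 (IsAffineModelAn (p := 2))
          full_galP_isAffineModelAn)).toLogFrobeniusData.coreObs5 H₅ hH₅).IsCore)
      (T : ((monoAnabelianData (AnabelianInput.ofFull 2 (IsAffineModelAn (p := 2))
          full_galP_isAffineModelAn)).toLogFrobeniusData.sub 4).Telecore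
        ((monoAnabelianData (AnabelianInput.ofFull 2 (IsAffineModelAn (p := 2))
          full_galP_isAffineModelAn)).toLogFrobeniusData.coreObs5 H₅ hH₅) hc)
      (K : ((monoAnabelianData (AnabelianInput.ofFull 2 (IsAffineModelAn (p := 2))
          full_galP_isAffineModelAn)).toLogFrobeniusData.teleDiagram T.J T.telMap).HomotopyFamily),
      (monoAnabelianData (AnabelianInput.ofFull 2 (IsAffineModelAn (p := 2))
          full_galP_isAffineModelAn)).toLogFrobeniusData.IsTelecoreAn
        (monoAnabelianData (AnabelianInput.ofFull 2 (IsAffineModelAn (p := 2))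
          full_galP_isAffineModelAn)).telecoreData T ∧
      (∀ ⦃a b : (LogFrobeniusData.teleShape T.J).Vertex⦄ (p q : Path a b), T.Jfam.E p q → K.E p q) ∧
      Literature.AnabelianGeometry.AbsoluteAnabelian.LogFrobeniusData.TeleLogPinned
        (monoAnabelianData (AnabelianInput.ofFull 2 (IsAffineModelAn (p := 2))
          full_galP_isAffineModelAn)).toLogFrobeniusData K :=
  exists_teleLogPinned_model _ _

end TFModel

end AbsTopIII

end Literature.AnabelianGeometry.AbsoluteAnabelian
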